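import Mathlib
import HarnessLib.Audit
import Summits.PneNP.PneNP.Theorems.PstarGateCaseTAffineWitness

/-!
# One GATED chord, CASE T with affine `q_mv`: two private `u`-avoiding edges on the gated cycle are impossible — the cube argument (E2 node N3X; prover-1 g19)

FRONTIER range-avoidance ladder, rung F-N3 (`stmt-PneNP-19007`), cell `pnp-ideate` (`PstarGateNodesX.GateOrFamilyX`); restricted-model proof
complexity — nothing here bears on `P` versus `NP`.

N3X setting (CASE T, `q_mv` affine, another chord).  Let `π = (α, α')`, `ν = (β, β')` be two edges of `D e` off `u` whose AND variables appear in no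
other edge of `D e`, and suppose no output read by the second constraint has a CROSS pair (`polarDir (1,0)(e_{π s}, e_{ν t}) = 0`).  Take the
minimality witness `x` at `π` (`PstarGateCaseTAffineWitness`: `x ∈ H₁`, `u_e(x) = 1`, `q(x) = σ₀ + [π ∈ T₂]`).  Along `α, α'` the value of
`u_e` changes by `x_{α'}, x_α, x_α + x_{α'} + 1` and `q` by `ℓ_α, ℓ_{α'}, ℓ_α + ℓ_{α'} + [π ∈ T₂]`; a flip `w` along `ν` switches `u_e` off.
The OFF-region pin `q = σ₀ + 1` (`caseT_off_q`) at the points `x + F₁ (+ w)` then gives `E(F₁) = Δ(F₁)·(1 + [π ∈ T₂])` for the three flips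
`F₁` along `π`, and summing the three identities yields `[π ∈ T₂] = 1 + [π ∈ T₂]`:

* `caseT_affine_cube_false` — **contradiction.**
-/

set_option linter.dupNamespace false -- `Summit.PneNP.PneNP.…`: summit = sub-problem name (D-0017 single-conjunct layout)

open Finset Module Literature.Computability.Complexity
open scoped symmDiff
open Summit.PneNP.PneNP.Theorems.PstarTyped (Typed)
open Summit.PneNP.PneNP.Theorems.PstarSALevel (BoundaryExpanding SimpleOverlap)
open Summit.PneNP.PneNP.Theorems.PstarGapLinearised (andPair)
open Summit.PneNP.PneNP.Theorems.PstarChordEndgameTools (mem_andPair_iff)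
open Summit.PneNP.PneNP.Theorems.PstarCubeIdeals (IsAffineFn)
open Summit.PneNP.PneNP.Theorems.PstarProductRank (qform polar)
open Summit.PneNP.PneNP.Theorems.PstarReadSumset (V2)
open Summit.PneNP.PneNP.Theorems.PstarChordSystem (ChordSystem)
open Summit.PneNP.PneNP.Theorems.PstarChordBridgeTools (privs coef)
open Summit.PneNP.PneNP.Theorems.PstarChordBridge (BridgeData sys)
open Summit.PneNP.PneNP.Theorems.PstarChordBridgeForcing (gam sys_u_eq)
open Summit.PneNP.PneNP.Theorems.PstarChordBridgeBasis (qDir polarDir)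
open Summit.PneNP.PneNP.Theorems.PstarChordBridgeCorner (qDir_add)
open Summit.PneNP.PneNP.Theorems.PstarGateBridge (GateHyp const_of_others)
open Summit.PneNP.PneNP.Theorems.PstarGateHyperplane (qform_single_and)
open Summit.PneNP.PneNP.Theorems.PstarGateCaseTLocal (u_add)
open Summit.PneNP.PneNP.Theorems.PstarNorUnitEQ1Tools (polarDir_single_pair)
open Summit.PneNP.PneNP.Theorems.PstarGateSharedEdge (polar_single_of_private)
open Summit.PneNP.PneNP.Theorems.PstarGateNodes (GateData)
open Summit.PneNP.PneNP.Theorems.PstarGateNodesX (GateDataX)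
open Summit.PneNP.PneNP.Theorems.PstarGateCaseTOffQ (caseT_off_q)
open Summit.PneNP.PneNP.Theorems.PstarGateCaseTRankSix (sigma_const)
open Summit.PneNP.PneNP.Theorems.PstarGateCaseTAffineWitness (caseT_affine_witness)

namespace Summit.PneNP.PneNP.Theorems.PstarGateCaseTCube

variable {n m : ℕ}

/-- The finite check: `ℓ_α = x_{α'}(1+τ)`, `ℓ_{α'} = x_α(1+τ)`, `ℓ_α + ℓ_{α'} + τ = (x_α + x_{α'} + 1)(1+τ)` is contradictory. -/
private theorem cube_aux (xa xa' τ la la' : ZMod 2) (h1 : la = xa' * (1 + τ)) (h2 : la' = xa * (1 + τ))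
    (h3 : la + la' + τ = (xa + xa' + 1) * (1 + τ)) : False := by
  subst h1 h2
  revert h3; revert xa xa' τ; decide

/-- Second differences of a quadratic function along two directions. -/
private theorem quad_two {q : (Fin n → ZMod 2) → ZMod 2} {Bf : LinearMap.BilinForm (ZMod 2) (Fin n → ZMod 2)}
    (hq : ∀ x w, q (x + w) = q x + q w + q 0 + Bf x w) (y v w : Fin n → ZMod 2) :
    q (y + v + w) = q (y + v) + q (y + w) + q y + Bf v w := by
  have h1 := hq (y + v) w
  have h2 := hq y w
  rw [map_add, LinearMap.add_apply] at h1
  rw [h1, h2]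
  generalize q (y + v) = a; generalize q y = b; generalize q w = c; generalize q 0 = d; generalize Bf y w = s; generalize Bf v w = t
  revert a b c d s t; decide

/-- **Two private `u`-avoiding edges on the gated cycle are impossible in N3X (no cross pairs).** -/
theorem caseT_affine_cube_false (I : LocalMap 4 n m) (hI : I.IsPure xorAndPred) (hT : Typed I) (hS : SimpleOverlap I) {r₀ : ℕ}
    (hB : BoundaryExpanding r₀ I) {B : BridgeData n m} {e g₀ : Fin m} {u : Fin n} {κ₀ : ZMod 2} (hD : GateDataX I r₀ B e g₀ u κ₀)
    {mv : V2} (hmvT : mv = (0, 1) ∨ mv = (1, 1))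
    (hP : ∀ e' ∈ B.N, e' ≠ e → ∀ a, ((sys I B).ρ e' a = 0 ∨ (sys I B).ρ e' a = mv) ∧ ((sys I B).ρ' e' a = 0 ∨ (sys I B).ρ' e' a = mv))
    (hread : ∀ e' ∈ B.N, e' ≠ e → ∀ a, (sys I B).ρ e' a ≠ 0 ∨ (sys I B).ρ' e' a ≠ 0) (hN : (B.N.erase e).Nonempty)
    (hqa : IsAffineFn (qDir I B mv)) {π ν : Fin m} (hπ : π ∈ B.D e) (hν : ν ∈ B.D e) (hπν : π ≠ ν)
    (hπ2 : I.vars π 2 ≠ u) (hπ3 : I.vars π 3 ≠ u) (hν2 : I.vars ν 2 ≠ u) (hν3 : I.vars ν 3 ≠ u)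
    (hpπ : ∀ j ∈ B.D e, j ≠ π → I.vars π 2 ∉ andPair I j ∧ I.vars π 3 ∉ andPair I j)
    (hpν : ∀ j ∈ B.D e, j ≠ ν → I.vars ν 2 ∉ andPair I j ∧ I.vars ν 3 ∉ andPair I j)
    (hcross : ∀ s t : Fin 4, 2 ≤ s.val → 2 ≤ t.val → polarDir I B (1, 0) (Pi.single (I.vars π s) 1) (Pi.single (I.vars ν t) 1) = 0) :
    False := by
  classical
  obtain ⟨hXc, hW, hr, hd₁, hd₂, -, -, -, hG, -⟩ := id hD
  have he : e ∈ B.N := hG.1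
  have hπJ : π ∈ B.J₀ := (mem_sdiff.1 (hW.hD e he hπ)).1
  obtain ⟨hκ, x, hxH, hue, hqx⟩ := caseT_affine_witness I hI hT hS hB hD hmvT hP hread hN hqa hπ hπ2 hπ3
  set σ₀ := ∑ i ∈ B.N.erase e, (((sys I B).ρ i 0).2 + ((sys I B).ρ' i 0).2) with hσ₀
  set τ : ZMod 2 := if π ∈ B.T₂ then 1 else 0 with hτ
  set q : (Fin n → ZMod 2) → ZMod 2 := qDir I B (1, 0) with hqdef
  set U : (Fin n → ZMod 2) → ZMod 2 := (sys I B).u e with hUdef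
  set Bq := polarDir I B (1, 0) with hBq
  set BU : LinearMap.BilinForm (ZMod 2) (Fin n → ZMod 2) := polar (B.D e) (fun j => I.vars j 2) (fun j => I.vars j 3) with hBU
  have hqq : ∀ y w, q (y + w) = q y + q w + q 0 + Bq y w := qDir_add I B (1, 0)
  have hUU : ∀ y w, U (y + w) = U y + U w + U 0 + BU y w := u_add I B e
  set α := I.vars π 2 with hα
  set α' := I.vars π 3 with hα'
  set β := I.vars ν 2 with hβ
  set β' := I.vars ν 3 with hβ'
  set eα : Fin n → ZMod 2 := Pi.single α 1 with heα
  set eα' : Fin n → ZMod 2 := Pi.single α' 1 with heα'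
  set eβ : Fin n → ZMod 2 := Pi.single β 1 with heβ
  set eβ' : Fin n → ZMod 2 := Pi.single β' 1 with heβ'
  have hαα' : α ≠ α' := fun h => absurd (hI.2 π h) (by decide)
  have hββ' : β ≠ β' := fun h => absurd (hI.2 ν h) (by decide)
  -- the off-region pin on the chamber
  have hoff : ∀ y : Fin n → ZMod 2, y u = 0 → U y = 0 → q y = 1 + σ₀ := by
    intro y hyu hUy
    have hyu' : y u = κ₀ + 1 := by rw [hyu, hκ]; decide
    have h := caseT_off_q I hI hT hD hmvT hP hread hyu' hUy
    rw [sigma_const I hW hG] at h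
    exact h
  have hxu : x u = 0 := by rw [hxH, hκ]; decide
  -- `U` at zero of single vectors
  have hU0 : ∀ v : Fin n, U (Pi.single v 1) = U 0 := by
    intro v; show (sys I B).u e _ = (sys I B).u e 0; rw [sys_u_eq, sys_u_eq, qform_single_and I hI]; unfold qform; simp
  -- polar values of `U` against the private directions
  have hBUα : ∀ y, BU eα y = y α' := fun y => polar_single_of_private I hI (B.D e) hπ (Or.inl ⟨hα.symm, hα'.symm⟩) (fun j hj hne => (hpπ j hj hne).1) y
  have hBUα' : ∀ y, BU eα' y = y α := fun y => polar_single_of_private I hI (B.D e) hπ (Or.inr ⟨hα.symm, hα'.symm⟩) (fun j hj hne => (hpπ j hj hne).2) y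
  have hBUβ : ∀ y, BU eβ y = y β' := fun y => polar_single_of_private I hI (B.D e) hν (Or.inl ⟨hβ.symm, hβ'.symm⟩) (fun j hj hne => (hpν j hj hne).1) y
  have hBUβ' : ∀ y, BU eβ' y = y β := fun y => polar_single_of_private I hI (B.D e) hν (Or.inr ⟨hβ.symm, hβ'.symm⟩) (fun j hj hne => (hpν j hj hne).2) y
  have hsymU : ∀ y w, BU y w = BU w y := PstarPathRank.polar_symm_and I (B.D e)
  -- distinctness of the four coordinates across the two edges
  have hαν : α ∉ andPair I ν := (hpπ ν hν (Ne.symm hπν)).1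
  have hα'ν : α' ∉ andPair I ν := (hpπ ν hν (Ne.symm hπν)).2
  have hαβ : α ≠ β := fun h => hαν ((mem_andPair_iff I ν α).2 (Or.inl (by rw [h])))
  have hαβ' : α ≠ β' := fun h => hαν ((mem_andPair_iff I ν α).2 (Or.inr (by rw [h])))
  have hα'β : α' ≠ β := fun h => hα'ν ((mem_andPair_iff I ν α').2 (Or.inl (by rw [h])))
  have hα'β' : α' ≠ β' := fun h => hα'ν ((mem_andPair_iff I ν α').2 (Or.inr (by rw [h])))
  -- a flip `w` along `ν` switching `U` off at `x`, orthogonal to `eα, eα'` for both forms, inside the chamber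
  obtain ⟨w, hwu, hwα, hwα', hUw, hBUαw, hBUα'w, hBqαw, hBqα'w⟩ : ∃ w : Fin n → ZMod 2, w u = 0 ∧ w α = 0 ∧ w α' = 0 ∧
      U (x + w) = U x + 1 ∧ BU eα w = 0 ∧ BU eα' w = 0 ∧ Bq eα w = 0 ∧ Bq eα' w = 0 := by
    have hc22 := hcross 2 2 (by decide) (by decide)
    have hc23 := hcross 2 3 (by decide) (by decide)
    have hc32 := hcross 3 2 (by decide) (by decide)
    have hc33 := hcross 3 3 (by decide) (by decide)
    have hUβ : U (x + eβ) = U x + x β' := by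
      have h := hUU x eβ; rw [hsymU, hBUβ, heβ, hU0, ← heβ] at h; rw [h]
      have e3 : ∀ a b c : ZMod 2, a + b + b + c = a + c := by decide
      exact e3 _ _ _
    have hUβ' : U (x + eβ') = U x + x β := by
      have h := hUU x eβ'; rw [hsymU, hBUβ', heβ', hU0, ← heβ'] at h; rw [h]
      have e3 : ∀ a b c : ZMod 2, a + b + b + c = a + c := by decide
      exact e3 _ _ _
    have hUββ' : U (x + eβ + eβ') = U x + x β + x β' + 1 := by
      rw [quad_two hUU x eβ eβ', hUβ, hUβ', hBUβ, heβ', Pi.single_eq_same]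
      have e4 : ∀ a b c : ZMod 2, a + c + (a + b) + a + 1 = a + b + c + 1 := by decide
      exact e4 _ _ _
    have z01 : ∀ t : ZMod 2, t = 0 ∨ t = 1 := by decide
    rcases z01 (x β') with h0 | h1
    · rcases z01 (x β) with h0' | h1'
      · refine ⟨eβ + eβ', ?_, ?_, ?_, ?_, ?_, ?_, ?_, ?_⟩
        · rw [Pi.add_apply, heβ, heβ', Pi.single_eq_of_ne (Ne.symm hν2), Pi.single_eq_of_ne (Ne.symm hν3), add_zero]
        · rw [Pi.add_apply, heβ, heβ', Pi.single_eq_of_ne hαβ, Pi.single_eq_of_ne hαβ', add_zero]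
        · rw [Pi.add_apply, heβ, heβ', Pi.single_eq_of_ne hα'β, Pi.single_eq_of_ne hα'β', add_zero]
        · rw [← add_assoc, hUββ', h0, h0']; ring
        · rw [map_add, hBUα, hBUα, heβ, heβ', Pi.single_eq_of_ne hα'β, Pi.single_eq_of_ne hα'β', add_zero]
        · rw [map_add, hBUα', hBUα', heβ, heβ', Pi.single_eq_of_ne hαβ, Pi.single_eq_of_ne hαβ', add_zero]
        · rw [map_add, hc22, hc23, add_zero]
        · rw [map_add, hc32, hc33, add_zero]
      · refine ⟨eβ', ?_, ?_, ?_, ?_, ?_, ?_, hc23, hc33⟩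
        · rw [heβ', Pi.single_eq_of_ne (Ne.symm hν3)]
        · rw [heβ', Pi.single_eq_of_ne hαβ']
        · rw [heβ', Pi.single_eq_of_ne hα'β']
        · rw [hUβ', h1']
        · rw [hBUα, heβ', Pi.single_eq_of_ne hα'β']
        · rw [hBUα', heβ', Pi.single_eq_of_ne hαβ']
    · refine ⟨eβ, ?_, ?_, ?_, ?_, ?_, ?_, hc22, hc32⟩
      · rw [heβ, Pi.single_eq_of_ne (Ne.symm hν2)]
      · rw [heβ, Pi.single_eq_of_ne hαβ]
      · rw [heβ, Pi.single_eq_of_ne hα'β]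
      · rw [hUβ, h1]
      · rw [hBUα, heβ, Pi.single_eq_of_ne hα'β]
      · rw [hBUα', heβ, Pi.single_eq_of_ne hαβ]
  -- values of `U` along the flips of `π`
  have hUα : U (x + eα) = U x + x α' := by
    have h := hUU x eα; rw [hsymU, hBUα, heα, hU0, ← heα] at h; rw [h]
    have e3 : ∀ a b c : ZMod 2, a + b + b + c = a + c := by decide
    exact e3 _ _ _
  have hUα' : U (x + eα') = U x + x α := by
    have h := hUU x eα'; rw [hsymU, hBUα', heα', hU0, ← heα'] at h; rw [h]
    have e3 : ∀ a b c : ZMod 2, a + b + b + c = a + c := by decide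
    exact e3 _ _ _
  have hUαα' : U (x + eα + eα') = U x + x α + x α' + 1 := by
    rw [quad_two hUU x eα eα', hUα, hUα', hBUα, heα', Pi.single_eq_same]
    have e4 : ∀ a b c : ZMod 2, a + c + (a + b) + a + 1 = a + b + c + 1 := by decide
    exact e4 _ _ _
  -- `U` after adding `w`: switched by one
  have hUw' : ∀ v : Fin n → ZMod 2, BU v w = 0 → U (x + v + w) = U (x + v) + 1 := by
    intro v hv
    rw [quad_two hUU x v w, hUw, hv]
    have e3 : ∀ a b : ZMod 2, a + (b + 1) + b + 0 = a + 1 := by decide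
    exact e3 _ _
  have hBUαα'w : BU (eα + eα') w = 0 := by rw [map_add, LinearMap.add_apply, hBUαw, hBUα'w, add_zero]
  -- `q` along the flips, with no cross terms
  have hqw' : ∀ v : Fin n → ZMod 2, Bq v w = 0 → q (x + v + w) = q (x + v) + q (x + w) + q x := by
    intro v hv; rw [quad_two hqq x v w, hv, add_zero]
  have hBqαα'w : Bq (eα + eα') w = 0 := by rw [map_add, LinearMap.add_apply, hBqαw, hBqα'w, add_zero]
  have hqαα' : q (x + eα + eα') = q (x + eα) + q (x + eα') + q x + τ := by
    rw [quad_two hqq x eα eα']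
    have h := polarDir_single_pair I hI hS hd₁ hd₂ (1, 0) hπJ
    simp only [zero_mul, zero_add, one_mul] at h
    rw [hBq, heα, heα', h]
  -- chamber membership of all points
  have heαu : eα u = 0 := by rw [heα, Pi.single_eq_of_ne (Ne.symm hπ2)]
  have heα'u : eα' u = 0 := by rw [heα', Pi.single_eq_of_ne (Ne.symm hπ3)]
  have hin : ∀ v : Fin n → ZMod 2, v u = 0 → (x + v) u = 0 := fun v hv => by rw [Pi.add_apply, hxu, hv, add_zero]
  have hin2 : ∀ v : Fin n → ZMod 2, v u = 0 → (x + v + w) u = 0 := fun v hv => by rw [Pi.add_apply, hin v hv, hwu, add_zero]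
  have heαα'u : (eα + eα') u = 0 := by rw [Pi.add_apply, heαu, heα'u, add_zero]
  -- the key identities `E(F₁) = Δ(F₁)(1+τ)`
  have hD₂ : q (x + w) + q x = 1 + τ := by
    have h := hoff (x + w) (hin w hwu) (by rw [hUw, hue]; decide)
    rw [h, hqx]
    have e3 : ∀ k t : ZMod 2, 1 + k + (t + k) = 1 + t := by decide
    exact e3 _ _
  have h2' : (2 : ZMod 2) = 0 := by decide
  have key : ∀ (v : Fin n → ZMod 2) (Δ : ZMod 2), v u = 0 → BU v w = 0 → Bq v w = 0 → U (x + v) = U x + Δ →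
      q (x + v) + q x = Δ * (1 + τ) := by
    intro v Δ hvu hBv hqv hUv
    have z01 : ∀ t : ZMod 2, t = 0 ∨ t = 1 := by decide
    rcases z01 Δ with hΔ | hΔ <;> rw [hΔ] at hUv ⊢
    · -- `U(x+v) = 1`: go through `x + v + w`, where `U = 0`
      have hU0' : U (x + v + w) = 0 := by rw [hUw' v hBv, hUv, hue]; decide
      have h := hoff _ (hin2 v hvu) hU0'
      rw [hqw' v hqv] at h
      linear_combination h - hD₂ - hqx + (q x - τ) * h2'
    · have hU0' : U (x + v) = 0 := by rw [hUv, hue]; decide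
      have h := hoff _ (hin v hvu) hU0'
      linear_combination h + hqx + σ₀ * h2'
  have k1 := key eα (x α') heαu hBUαw hBqαw hUα
  have k2 := key eα' (x α) heα'u hBUα'w hBqα'w hUα'
  have k3 := key (eα + eα') (x α + x α' + 1) heαα'u hBUαα'w hBqαα'w (by rw [← add_assoc, hUαα']; ring)
  rw [← add_assoc, hqαα'] at k3
  refine cube_aux (x α) (x α') τ (q (x + eα) + q x) (q (x + eα') + q x) k1 k2 ?_
  linear_combination k3

end Summit.PneNP.PneNP.Theorems.PstarGateCaseTCube
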